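import Mathlib.MeasureTheory.Measure.Lebesgue.Basic
import Mathlib.Analysis.SpecialFunctions.Log.Basic
import Mathlib.Topology.Algebra.InfiniteSum.ENNReal
import HarnessLib

/-!
# Diophantine selection (RH-free stub of crux `OddSector.OddOneSignedWindows`)

Stub `stub_diophantineSelection` of the line `Sketch` of crux item stmt-RiemannHypothesis-17778
(card `resonance-transport-diophantine`, reshaped): pure measure theory on `ℝ`, no number theory.

For a non-negative summable family of radii `ψ N M` (`N, M : ℕ`) with `Σ_{N,M} ψ N M < 1/2`, the
tubes `{a : |a − log (N/M)| < ψ N M}` are the open balls `ball (log (N/M)) (ψ N M)`, of total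
Lebesgue measure `≤ Σ_{N,M} 2 ψ N M < 1 = volume [a₁, a₁ + 1]` (countable union bound
`measure_iUnion_le`, `Real.volume_ball`, `ENNReal.ofReal_tsum_of_nonneg`); hence the unit interval
`[a₁, a₁ + 1]` is not covered by the tubes, and any uncovered point `a` satisfies
`ψ N M ≤ |a − log (N/M)|` for all `N, M` (in particular for `N, M ≥ 1`).

Deliberately NOT here: the RH-strength core `stub_diophantineCore` and the composition
`OddOneSignedWindows_of` (they live in the line skeleton held by the lead).
-/

set_option linter.dupNamespace false

open Set MeasureTheory

namespace Summit.RiemannHypothesis.RiemannHypothesis.Theorems.OddSector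

/-- **Countable union bound for tubes on the line.** If `ψ ≥ 0` is summable over `ℕ × ℕ` with
`Σ ψ < 1/2`, the union of the balls `ball (log (N/M)) (ψ N M)` has Lebesgue measure `< 1`, hence
strictly less than the measure of any unit interval `[a₁, a₁ + 1]`. [folklore] -/
private theorem volume_iUnion_ball_log_lt (ψ : ℕ → ℕ → ℝ) (h0 : ∀ N M, 0 ≤ ψ N M)
    (hsum : Summable (fun p : ℕ × ℕ => ψ p.1 p.2)) (hlt : ∑' p : ℕ × ℕ, ψ p.1 p.2 < 1 / 2)
    (a₁ : ℝ) :
    volume (⋃ p : ℕ × ℕ, Metric.ball (Real.log ((p.1 : ℝ) / p.2)) (ψ p.1 p.2)) <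
      volume (Icc a₁ (a₁ + 1)) := by
  have h1 : volume (Icc a₁ (a₁ + 1)) = 1 := by
    rw [Real.volume_Icc, add_sub_cancel_left, ENNReal.ofReal_one]
  have hnn : ∀ p : ℕ × ℕ, 0 ≤ 2 * ψ p.1 p.2 := fun p => mul_nonneg zero_le_two (h0 p.1 p.2)
  have hs2 : Summable (fun p : ℕ × ℕ => 2 * ψ p.1 p.2) := hsum.mul_left 2
  have h2 : volume (⋃ p : ℕ × ℕ, Metric.ball (Real.log ((p.1 : ℝ) / p.2)) (ψ p.1 p.2)) ≤
      ENNReal.ofReal (2 * ∑' p : ℕ × ℕ, ψ p.1 p.2) :=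
    calc volume (⋃ p : ℕ × ℕ, Metric.ball (Real.log ((p.1 : ℝ) / p.2)) (ψ p.1 p.2))
        ≤ ∑' p : ℕ × ℕ, volume (Metric.ball (Real.log ((p.1 : ℝ) / p.2)) (ψ p.1 p.2)) :=
          measure_iUnion_le _
      _ = ∑' p : ℕ × ℕ, ENNReal.ofReal (2 * ψ p.1 p.2) := by simp_rw [Real.volume_ball]
      _ = ENNReal.ofReal (∑' p : ℕ × ℕ, 2 * ψ p.1 p.2) :=
          (ENNReal.ofReal_tsum_of_nonneg hnn hs2).symm
      _ = ENNReal.ofReal (2 * ∑' p : ℕ × ℕ, ψ p.1 p.2) := by rw [tsum_mul_left]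
  have h3 : ENNReal.ofReal (2 * ∑' p : ℕ × ℕ, ψ p.1 p.2) < 1 := by
    rw [← ENNReal.ofReal_one, ENNReal.ofReal_lt_ofReal_iff one_pos]
    linarith
  rw [h1]
  exact h2.trans_lt h3

/-- **Diophantine selection (RH-free).** For every non-negative summable family of radii
`ψ N M` with `Σ_{N,M} ψ N M < 1/2`, every unit interval `[a₁, a₁ + 1]` contains a window `a`
keeping distance `≥ ψ N M` from `log (N/M)` for all `N, M ≥ 1`: the tubes
`|a − log (N/M)| < ψ N M` have total length `≤ 2 Σ ψ < 1 = |[a₁, a₁ + 1]|`, so they cannot cover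
the interval (`volume_iUnion_ball_log_lt` + monotonicity of Lebesgue measure). [folklore] -/
theorem stub_diophantineSelection :
    ∀ (ψ : ℕ → ℕ → ℝ), (∀ N M, 0 ≤ ψ N M) → Summable (fun p : ℕ × ℕ => ψ p.1 p.2) →
      ∑' p : ℕ × ℕ, ψ p.1 p.2 < 1 / 2 →
        ∀ a₁ : ℝ, ∃ a ∈ Icc a₁ (a₁ + 1), ∀ N M : ℕ, 1 ≤ N → 1 ≤ M →
          ψ N M ≤ |a - Real.log ((N : ℝ) / M)| := by
  intro ψ h0 hsum hlt a₁
  have hns : ¬ (Icc a₁ (a₁ + 1) ⊆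
      ⋃ p : ℕ × ℕ, Metric.ball (Real.log ((p.1 : ℝ) / p.2)) (ψ p.1 p.2)) :=
    fun hsub => absurd (measure_mono hsub) (not_le.2 (volume_iUnion_ball_log_lt ψ h0 hsum hlt a₁))
  obtain ⟨a, ha, hnot⟩ := Set.not_subset.1 hns
  refine ⟨a, ha, fun N M _ _ => ?_⟩
  simp only [Set.mem_iUnion, not_exists, Metric.mem_ball, Real.dist_eq, not_lt] at hnot
  exact hnot (N, M)

end Summit.RiemannHypothesis.RiemannHypothesis.Theorems.OddSector
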